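import Summits.QuantumFields.BalabanUV.Beta.D1BFx.RoadEndBFxTotalMeanSbpS
import Summits.QuantumFields.BalabanUV.Beta.D1BFx.RoadEndBFxWiredMeanS

/-!
# `BalabanUV.Beta.D1BFx.RoadEndBFxWiredMeanSbpS` — road «BF-x» for binder row D1, slot (K): **THE «END-ii» END IN THE MEAN LANE WITH NO LEG ROW** — my g17
# `RoadEndBFxWiredMeanS` (p298064) §1–§3 with the shell rows `h2s` ∕ `d2s` (and their idle constants `hD₂` ∕ `hA₂` ∕ `hδ₂`) DELETED, over the OWNER d1-p2-g13's
# summation-by-parts scalar wall («C3-SBP», `SbpScalarEnd` PARTs 1–4) through `RoadEndBFxTotalMeanSbpS.d1Drift_BFx_total_mean_sbp_of_prop12S`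

HONEST DEPENDENCY (cell records, verbatim): «continuum YM on T⁴ ⇐ BetaPertH ∧ nine spine estimates (0/9 proved); BetaPertH ⇐ (D1) ∧ (D4) ∧
CAP+tail; G-an2-4 gates asym, D1 and NE2/3/4.»  HONEST FRAMING (cell contract, verbatim): «discharging `BetaPertH` makes Bałaban's UV stability
UNCONDITIONAL — a real constructive-QFT result; it is NOT the continuum limit and NOT the Clay problem.»  THIS MODULE DISCHARGES NOTHING of the
wall: [folklore] composition BY NAME — the bodies of `RoadEndBFxWiredMeanS` §1–§3 with the callee `RoadEndBFxTotalMeanShellS.d1Drift_BFx_total_mean_shell_of_prop12S ↦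
RoadEndBFxTotalMeanSbpS.d1Drift_BFx_total_mean_sbp_of_prop12S` (mean-lane link 3, no second-difference row), `RestTotalOfGroupsS.hRestTot_of_hGroupsS` (one bound per
identity-closed group ⟹ the rest total), `RoadEndGroupsS.hGrp_of_prop12S` (the group rows under reading (ii)), and, for §3, `NeedleTadpoleRowDecay.h₈_of_blockRate_scaling` +
`GhostKernelComplete.hasSum_row_fineHessGhQ_ray`.  No `def`, no `def … : Prop`, nothing cited, 0 sorry.  Root-level binders hW ∕ hR-sockets ∕ hSX-socket ∕ D1Tel ∕ D1Rep — 0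
discharged; (K) NOT closed; the all-scales bound `hall` is row G-an2-4's and is DISPLAYED; NOT D1, NOT `BetaPertH`, NOT continuum, NOT Clay.

ABSOLUTE RULE (cell charter, verbatim): «No internally-minted statement may enter as a cited fact. Every hypothesis is either kernel-proved in
this package or a verbatim quotation of a PUBLISHED theorem with page reference. The manuscript(s) under audit are NOT citable for their own
disputed steps — they are the thing under adjudication; programme-internal (2001/route/tribunal) claims are never citable.»

WHY (owner d1-p2-g13 FINDING F-g13-1, journal l.35219 «C3-SBP»; OFFER → leaf-01 for the mean lane).  Every END of road BF-x displayed the two SHELL rows of the frozen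
profile `gfrz n a b` («ROUTE P, an5 class»).  The owner's `SbpShellRemainder.sbp_A1` ∕ `SbpScalarEnd.d1Drift_of_strongRoad_sbp` show the wall never needed them; the four
remaining leg rows h0∕h1∕d0∕d1 are theorems (`FrozenLegProfile`) ∕ consequences of the printed statements `h12`∕`h126` (`FrozenLegTails`).  After this file the MEAN-lane
END-ii END (§3) displays ONLY: `hall`∕`hθ0`∕`hθ1`, B1_mean, (K) `hK`, the tie `hωs` + pin `hs` + `hlam`, the pins `hcE`∕`hRsgn`∕`hJ4`, the ray + P13, the five slot-table
sockets (+ covariance, bond swap), `hdiv`, slot E's support ∕ rate floor ∕ units, slot R's and slot Q's SOCKETS, the (Λ) data, (U), `h12`∕`h126` — NO leg row, NO rest-word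
row, NO Ward row.  CHECK-N0 items OUTSIDE this file (an2 ∕ binder), verbatim from `RoadEndBFxWiredS`: Q-GU-1′(a), S-x₀, N0-abs, Q-GU-aux.

CONTENT.
* §1 [folklore] **`d1Drift_BFx_total_mean_sbp_of_prop12_of_groupsS`** = `RoadEndBFxWiredMeanS.d1Drift_BFx_total_mean_shell_of_prop12_of_groupsS` minus `hD₂ hA₂ hδ₂ h2s d2s`.
* §2 [folklore] **`d1Drift_BFx_mean_sbp_of_prop12S`** — THE MEAN-LANE «END-ii» END, NO LEG ROW (`h₈` displayed) = `…d1Drift_BFx_mean_of_prop12S` minus the same five.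
* §3 [folklore] **`d1Drift_BFx_mean_sbp_of_prop12S'`** — v1.1 SHAPE: T₈ through the slot-Q sockets, `hrowgh` on the ray = `…d1Drift_BFx_mean_of_prop12S'` minus the same five.
Unit `b2b-balaban-beta-d1-formalise-leaf-01` (gen 18), D1 formalisation swarm leaf prover 01, road «BF-x» MEAN lane; `LEAVES-BFx.md` rows «C3-SBP» (twins), «END-WIRED-S ∕ END-ii»
(mean lane) and A7-ENDₛ; END-ii-SPEC v1.2 §6.
-/

noncomputable section

open Finset Filter Topology
open Literature.Probability.LatticeModels (annulus)
open scoped BigOperators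
open Literature.MathematicalPhysics.QuantumFieldTheory
open Literature.MathematicalPhysics.QuantumFieldTheory.Balaban1983to89
open Literature.MathematicalPhysics.QuantumFieldTheory.Balaban1983to89.Beta
open RemainderConstAllScales (AllScalesSeq)
open OneStepResolventKernel (JetData KInv)
open OneStepKernelFamily (TbalOf D1Drift)
open InterLevelTransport (onLat)
open BalabanStepJets (lamCoeffOf)
open AveragingHessianKernels (hessFF)
open KernelWard (divV)
open WindowIdentification (fullSum)
open B12Sec2to5 (l1)
open DyadicShell (Pt toReal supNorm)
open ExpKernelCalculus (Site MKer BiLoc shiftK comp)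
open GhostTable (gFree)
open BubbleTransfer (unitVec)
open DressedMomentNormalisation (resSite)
open Summit.QuantumFields.BalabanUV.Beta.TameKernelCalculus (Spr Loc trK)
open Summit.QuantumFields.BalabanUV.Beta.D1BFx.ReducedKernel (TableR TOfRed)
open Summit.QuantumFields.BalabanUV.Beta.D1BFx.DressedTadpoleTable (tableRed tadpoleTable)
open Summit.QuantumFields.BalabanUV.Beta.D1BFx.ReducedKernelSandwich (fineHess)
open Summit.QuantumFields.BalabanUV.Beta.D1BFx.FineStencilBF (ffOf)
open Summit.QuantumFields.BalabanUV.Beta.D1BFx.FineStencilBFBalaban (SbfBal)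
open Summit.QuantumFields.BalabanUV.Beta.D1BFx.SecondStencilBF (Wbf)
open Summit.QuantumFields.BalabanUV.Beta.D1BFx.GhostKernelComplete (PghQ fineHessGhQ)
open Summit.QuantumFields.BalabanUV.Beta.D1BFx.GluonLeg (Ga)
open Summit.QuantumFields.BalabanUV.Beta.D1BFx.FrozenLegProfile (gfrz)
open Summit.QuantumFields.BalabanUV.Beta.D1BFx.SplitInstance (RestIdx)
open Summit.QuantumFields.BalabanUV.Beta.D1BFx.SplitInstanceS (restKS)
open Summit.QuantumFields.BalabanUV.Beta.D1BFx.RoadEndBFxRecut (cornerIdx)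
open Summit.QuantumFields.BalabanUV.Beta.D1BFx.RoadEndBFxRows (grpRec grpRec_eq_three_iff)
open Summit.QuantumFields.BalabanUV.Beta.D1BFx.RestTotalOfGroupsS (hRestTot_of_hGroupsS)
open Summit.QuantumFields.BalabanUV.Beta.D1BFx.RoadEndGroupsS (hGrp_of_prop12S)
open Summit.QuantumFields.BalabanUV.Beta.D1BFx.RoadEndBFxTotalMeanSbpS (d1Drift_BFx_total_mean_sbp_of_prop12S)
open Summit.QuantumFields.BalabanUV.Beta.D1BFx.NeedleTadpoleRowDecay (h₈_of_blockRate_scaling)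
open Summit.QuantumFields.BalabanUV.Beta.D1BFx.FrozenLegTails (nOf MOf hn1)
open Summit.QuantumFields.BalabanUV.Beta.D1BFx.GluonLegTails (hGa_of_prop12)
open VectorTailsLoc (fam kfam)

namespace Summit.QuantumFields.BalabanUV.Beta.D1BFx.RoadEndBFxWiredMeanSbpS

variable {Lc : ℕ} [NeZero Lc] {a N cgh₀ : ℝ} {μ ν : Fin 4} {υ : Type*} [Fintype υ]
  {cE cVH cΛ cR cK cQ cE₂ cJ4 cΛ₂ cR₂ cQ₂ x₀ ωgl ωgh cgh : ℕ → ℝ} {WE WJ WΛ WR WQ : ℕ → TableR} {CE CJ CΛt CRt CQ δW : ℕ → ℝ}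
  {Ru : υ → ℕ → ℝ} {CU : υ → ℝ} {κ θ : ℝ}
  {TΛ WA : ℕ → Fin 4 → Site 4 → Fin 4 → Site 4 → MKer 4 (Fin 4)} {CT δT : ℕ → ℝ}
  {ε : ℕ → ℝ} {X : ℕ → Site 4 → MKer 4 (Fin 4)} {Cx δx : ℕ → ℝ}
  {G : Type*} [Fintype G] [DecidableEq G] {grp : RestIdx → G} {g₀ : G} {CG : G → ℝ}

/-! ## §1 The MEAN-grading total-rest END fed by ONE bound per identity-closed group (mean-lane twin of chain link 5) -/

/-- [folklore] **ROAD BF-x, MEAN GRADING: THE «ENDₛ» DEBT END (total-rest form, NO second-difference row, d0∕d1 + (α) from the printed statements) FED BY GROUP REST BOUNDS** —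
`RoadEndBFxWiredMeanS.d1Drift_BFx_total_mean_shell_of_prop12_of_groupsS` with `hD₂ hA₂ hδ₂ h2s d2s` DELETED: `RoadEndBFxTotalMeanSbpS.d1Drift_BFx_total_mean_sbp_of_prop12S` (any `Js`
under the displayed all-scales bound `hall`∕`hθ0`∕`hθ1`, bridge B1 in CESÀRO form) with `hRestTot` supplied by `RestTotalOfGroupsS.hRestTot_of_hGroupsS` from ONE n-uniform
bound `CG g` per group `g ≠ g₀` of a label `grp : RestIdx → G` of the two-profile rest words `restKS (gfrz n a b) (s n • gfrz n a b)` whose fibre `g₀` is exactly the corner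
(`hcorner`), `CRtot := Σ_{g ≠ g₀} CG g`; the glue's (α)-leaf input is `GluonLegTails.hGa_of_prop12` (from `h12`∕`h126` BY NAME).  Displayed: `hall`∕`hθ0`∕`hθ1`, B1_mean,
(K) `hK` + `hωs` + `hlam`, the five slot-table sockets, `hdiv`, `hrowgh`, the partition datum `hcorner`, ONE bound per group `hGrp`, (U), `h12`∕`h126` — NO leg row. -/
theorem d1Drift_BFx_total_mean_sbp_of_prop12_of_groupsS (Js : ℕ → JetData 3 Lc) (hμν : μ ≠ ν) (hN : N ≠ 0) (hL : 2 ≤ Lc) (hodd : Odd Lc) (ha : 0 < a)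
    (c : ℕ → ℝ)
    (hall : AllScalesSeq (fun j => B12Beta.secondMoment (TbalOf Lc Js j) μ ν) κ θ) (hθ0 : 0 ≤ θ) (hθ1 : θ < 1)
    (h12 : B5.Prop12Printed (fam nOf hn1 MOf a ha)) (h126 : B5.Kernel126_127Printed (kfam nOf MOf))
    (hB1 : Tendsto (fun m : ℕ => ((∑ j ∈ range m, B12Beta.secondMoment (TbalOf Lc Js j) μ ν) - c (Lc ^ m)) / (m : ℝ)) atTop (𝓝 0))
    (hK : ∀ n : ℕ, 2 ≤ n → Odd n → ∀ [NeZero n], c n =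
      ωgl n * B12Beta.secondMoment (TOfRed n a (SbfBal n a (cE n) (cVH n) (cΛ n) (cR n) (cK n) (cQ n))
        (tableRed n (Wbf (cE₂ n) (cJ4 n) (cΛ₂ n) (cR₂ n) (cQ₂ n) (WE n) (WJ n) (WΛ n) (WR n) (WQ n)))) μ ν
      + ωgh n * B12Beta.secondMoment (PghQ n a (x₀ n) (cK n) (cQ n)) μ ν + ∑ u, Ru u n)
    (s : ℕ → ℝ) (hωs : ∀ n : ℕ, 2 ≤ n → ωgh n * (s n * cK n) ^ 2 = -2 * (ωgl n * cE n ^ 2))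
    (hlam : ∀ n : ℕ, 2 ≤ n → ωgl n * cE n ^ 2 = 2 * N ^ 2 * (n : ℝ) ^ 8)
    (hδW : ∀ n, 0 < δW n)
    (hE : ∀ n κ u l u', BiLoc (WE n κ u l u') u u' (CE n) (δW n)) (hJ : ∀ n κ u l u', BiLoc (WJ n κ u l u') u u' (CJ n) (δW n))
    (hΛ : ∀ n κ u l u', BiLoc (WΛ n κ u l u') u u' (CΛt n) (δW n)) (hR : ∀ n κ u l u', BiLoc (WR n κ u l u') u u' (CRt n) (δW n))
    (hQ : ∀ n κ u l u', BiLoc (WQ n κ u l u') u u' (CQ n) (δW n))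
    (hEc : ∀ (n : ℕ) (κ : Fin 4) (u : Site 4) (l : Fin 4) (u' t : Site 4),
      WE n κ (u + (n : ℤ) • t) l (u' + (n : ℤ) • t) = shiftK (-((n : ℤ) • t)) (WE n κ u l u'))
    (hJc : ∀ (n : ℕ) (κ : Fin 4) (u : Site 4) (l : Fin 4) (u' t : Site 4),
      WJ n κ (u + (n : ℤ) • t) l (u' + (n : ℤ) • t) = shiftK (-((n : ℤ) • t)) (WJ n κ u l u'))
    (hΛc : ∀ (n : ℕ) (κ : Fin 4) (u : Site 4) (l : Fin 4) (u' t : Site 4),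
      WΛ n κ (u + (n : ℤ) • t) l (u' + (n : ℤ) • t) = shiftK (-((n : ℤ) • t)) (WΛ n κ u l u'))
    (hRc : ∀ (n : ℕ) (κ : Fin 4) (u : Site 4) (l : Fin 4) (u' t : Site 4),
      WR n κ (u + (n : ℤ) • t) l (u' + (n : ℤ) • t) = shiftK (-((n : ℤ) • t)) (WR n κ u l u'))
    (hQc : ∀ (n : ℕ) (κ : Fin 4) (u : Site 4) (l : Fin 4) (u' t : Site 4),
      WQ n κ (u + (n : ℤ) • t) l (u' + (n : ℤ) • t) = shiftK (-((n : ℤ) • t)) (WQ n κ u l u'))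
    (hEs : ∀ n κ u l u', WE n κ u l u' = WE n l u' κ u) (hJs : ∀ n κ u l u', WJ n κ u l u' = WJ n l u' κ u)
    (hΛs : ∀ n κ u l u', WΛ n κ u l u' = WΛ n l u' κ u) (hRs : ∀ n κ u l u', WR n κ u l u' = WR n l u' κ u)
    (hQs : ∀ n κ u l u', WQ n κ u l u' = WQ n l u' κ u)
    (hdiv : ∀ n : ℕ, 2 ≤ n → ∀ [NeZero n], ∀ (l' : Fin 4) (u' u : Site 4), ∑ κ' : Fin 4,
      (fineHess n a (SbfBal n a (cE n) (cVH n) (cΛ n) (cR n) (cK n) (cQ n))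
          (Wbf (cE₂ n) (cJ4 n) (cΛ₂ n) (cR₂ n) (cQ₂ n) (WE n) (WJ n) (WΛ n) (WR n) (WQ n)) κ' l' (u - Pi.single κ' 1) u'
        - fineHess n a (SbfBal n a (cE n) (cVH n) (cΛ n) (cR n) (cK n) (cQ n))
          (Wbf (cE₂ n) (cJ4 n) (cΛ₂ n) (cR₂ n) (cQ₂ n) (WE n) (WJ n) (WΛ n) (WR n) (WQ n)) κ' l' u u') = 0)
    (hrowgh : ∀ n : ℕ, 2 ≤ n → ∀ [NeZero n], ∀ (κ' l' : Fin 4) (b : Site 4), HasSum (fineHessGhQ n a (x₀ n) (cK n) (cQ n) κ' l' b) 0)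
    -- (REST-GROUPS): the rest words labelled by `grp`, the corner exactly the fibre of `g₀`; ONE n-UNIFORM bound per group `g ≠ g₀`; (U)
    (hcorner : ∀ τ : RestIdx, grp τ = g₀ ↔ τ = cornerIdx)
    (hGrp : ∀ n : ℕ, 2 ≤ n → ∀ [NeZero n], ∀ g : G, g ≠ g₀ →
      |∑ b ∈ (univ : Finset (Fin 4 → Fin n)).image resSite, ((n : ℝ) ^ 4)⁻¹ *
        fullSum (fun w : Pt => ∑ τ ∈ (univ : Finset RestIdx).filter (fun τ => grp τ = g),
          restKS n a (gfrz n a b) (fun v => s n * gfrz n a b v) (cE n) (cΛ n) (cR n) (cK n) (cQ n) (cE₂ n) (cJ4 n) (cΛ₂ n) (cR₂ n) (cQ₂ n) (x₀ n)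
            (WE n) (WJ n) (WΛ n) (WR n) (WQ n) (ωgl n) (ωgh n) ((n : ℝ) ^ 8) N μ ν b τ w)| ≤ CG g)
    (hU : ∀ n : ℕ, 2 ≤ n → ∀ u, |Ru u n| ≤ CU u) :
    D1Drift Lc Js N μ ν :=
  d1Drift_BFx_total_mean_sbp_of_prop12S Js hμν hN hL hodd ha c hall hθ0 hθ1 h12 h126 hB1 hK s hωs hlam hδW hE hJ hΛ hR hQ
    hEc hJc hΛc hRc hQc hEs hJs hΛs hRs hQs hdiv hrowgh
    (hRestTot_of_hGroupsS ha hμν (hGa_of_prop12 ha h12 h126) hδW hE hJ hΛ hR hQ s hcorner hGrp) hU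

/-! ## §2 THE MEAN-LANE «END-ii» END: the rest row wired under the consistent ghost reading, T₈ displayed -/

/-- [folklore] **ROAD BF-x, THE MEAN-LANE «END-ii» END WITH NO LEG ROW: THE MEAN-GRADING DEBT END WITH THE REST ROW WIRED UNDER THE CONSISTENT GHOST READING** —
`RoadEndBFxWiredMeanS.d1Drift_BFx_mean_of_prop12S` (the mean-lane twin of `RoadEndBFxWiredS.d1Drift_BFx_of_prop12S`) with `hD₂ hA₂ hδ₂ h2s d2s` DELETED: §1 at the label of record `grp := grpRec`, `g₀ := 3` (`grpRec_eq_three_iff`) with the group bounds SUPPLIED by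
`RoadEndGroupsS.hGrp_of_prop12S` — gluon rows T₁–T₃ (record), «L-GBUB» ×3 and T₄–T₇ tree theorems under reading (ii) (`GhostBubbleTailsII`, `NeedleGhostBubbleRowMass10{,T5}`,
`NeedleGhostBubble2RowMass8`, `NeedleGhostTadpoleRowMass8`).  `D1Drift Lc Js N μ ν` for ANY `Js`, `μ ≠ ν`, `N ≠ 0`, odd `Lc ≥ 2`, from, DISPLAYED VERBATIM: the all-scales
bound `hall`∕`hθ0`∕`hθ1` on `β⁰_j := secondMoment (TbalOf Lc Js j) μ ν` (row G-an2-4) and bridge B1 in CESÀRO form (instead of the total-shell lane's uniform `hB1`); (K) `hK` +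
`hωs` + `hs` + `hlam`; the pins `hcE`∕`hRsgn`∕`hJ4`; the ray `hKray`∕`hQray`∕`hx` with `|cgh n| ≤ cgh₀` (P13); the five slot-table sockets with covariance and bond swap; `hdiv`;
`hrowgh`; NO leg row (h0∕h1∕d0∕d1 are theorems ∕ printed); slot-E's support ∕ rate floor ∕ units; slot R's SOCKETS (`hWRenv`, `hkR`, …); the (Λ) sockets + `cΛ ≠ 0`, `ε = ±1`, `hX`, (W1), (W2′); (U);
the two PRINTED statements `h12`∕`h126` BY NAME; and ONE open rest input, the slot-4 tadpole row `h₈` (T₈: `WQ` awaits the (A2) pin).  HONEST: composition BY NAME; root-level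
binders hW ∕ hR-sockets ∕ hSX-socket ∕ D1Tel ∕ D1Rep — 0 discharged; `hall` is row G-an2-4's (displayed); (K) NOT closed; NOT D1, NOT `BetaPertH`, NOT continuum, NOT Clay. -/
theorem d1Drift_BFx_mean_sbp_of_prop12S (Js : ℕ → JetData 3 Lc) (hμν : μ ≠ ν) (hN : N ≠ 0) (hL : 2 ≤ Lc) (hodd : Odd Lc)
    (ha : 0 < a) (c : ℕ → ℝ)
    (h12 : B5.Prop12Printed (fam nOf hn1 MOf a ha)) (h126 : B5.Kernel126_127Printed (kfam nOf MOf))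
    -- MEAN grading: the displayed all-scales bound on the step coefficients (row G-an2-4) and bridge B1 in CESÀRO form
    (hall : AllScalesSeq (fun j => B12Beta.secondMoment (TbalOf Lc Js j) μ ν) κ θ) (hθ0 : 0 ≤ θ) (hθ1 : θ < 1)
    (hB1 : Tendsto (fun m : ℕ => ((∑ j ∈ range m, B12Beta.secondMoment (TbalOf Lc Js j) μ ν) - c (Lc ^ m)) / (m : ℝ)) atTop (𝓝 0))
    (hK : ∀ n : ℕ, 2 ≤ n → Odd n → ∀ [NeZero n], c n =
      ωgl n * B12Beta.secondMoment (TOfRed n a (SbfBal n a (cE n) (cVH n) (cΛ n) (cR n) (cK n) (cQ n))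
        (tableRed n (Wbf (cE₂ n) (cJ4 n) (cΛ₂ n) (cR₂ n) (cQ₂ n) (WE n) (WJ n) (WΛ n) (WR n) (WQ n)))) μ ν
      + ωgh n * B12Beta.secondMoment (PghQ n a (x₀ n) (cK n) (cQ n)) μ ν + ∑ u, Ru u n)
    -- the RESCALED loop-weight tie of reading (ii): displayed scalar family `s`, pinned `s n = n⁻²`; the normalisation
    (s : ℕ → ℝ) (hs : ∀ n : ℕ, 2 ≤ n → s n = ((n : ℝ) ^ 2)⁻¹) (hωs : ∀ n : ℕ, 2 ≤ n → ωgh n * (s n * cK n) ^ 2 = -2 * (ωgl n * cE n ^ 2))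
    (hlam : ∀ n : ℕ, 2 ≤ n → ωgl n * cE n ^ 2 = 2 * N ^ 2 * (n : ℝ) ^ 8)
    -- pins and the ray (the rows' letters)
    (hcE : ∀ n : ℕ, 2 ≤ n → cE n = (n : ℝ) ^ 4) (hRsgn : ∀ n : ℕ, 2 ≤ n → cR n = -cE n) (hJ4 : ∀ n : ℕ, cJ4 n = 0)
    (hcgh : ∀ n : ℕ, |cgh n| ≤ cgh₀) (hKray : ∀ n : ℕ, cK n = cgh n * (n : ℝ) ^ 2) (hQray : ∀ n : ℕ, cQ n = cgh n * a) (hx : ∀ n : ℕ, x₀ n = -cgh n)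
    -- slot-table sockets (the END's), covariance, bond swap
    (hδW : ∀ n, 0 < δW n)
    (hE : ∀ n κ u l u', BiLoc (WE n κ u l u') u u' (CE n) (δW n)) (hJ : ∀ n κ u l u', BiLoc (WJ n κ u l u') u u' (CJ n) (δW n))
    (hΛ : ∀ n κ u l u', BiLoc (WΛ n κ u l u') u u' (CΛt n) (δW n)) (hR : ∀ n κ u l u', BiLoc (WR n κ u l u') u u' (CRt n) (δW n))
    (hQ : ∀ n κ u l u', BiLoc (WQ n κ u l u') u u' (CQ n) (δW n))
    (hEc : ∀ (n : ℕ) (κ : Fin 4) (u : Site 4) (l : Fin 4) (u' t : Site 4),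
      WE n κ (u + (n : ℤ) • t) l (u' + (n : ℤ) • t) = shiftK (-((n : ℤ) • t)) (WE n κ u l u'))
    (hJc : ∀ (n : ℕ) (κ : Fin 4) (u : Site 4) (l : Fin 4) (u' t : Site 4),
      WJ n κ (u + (n : ℤ) • t) l (u' + (n : ℤ) • t) = shiftK (-((n : ℤ) • t)) (WJ n κ u l u'))
    (hΛc : ∀ (n : ℕ) (κ : Fin 4) (u : Site 4) (l : Fin 4) (u' t : Site 4),
      WΛ n κ (u + (n : ℤ) • t) l (u' + (n : ℤ) • t) = shiftK (-((n : ℤ) • t)) (WΛ n κ u l u'))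
    (hRc : ∀ (n : ℕ) (κ : Fin 4) (u : Site 4) (l : Fin 4) (u' t : Site 4),
      WR n κ (u + (n : ℤ) • t) l (u' + (n : ℤ) • t) = shiftK (-((n : ℤ) • t)) (WR n κ u l u'))
    (hQc : ∀ (n : ℕ) (κ : Fin 4) (u : Site 4) (l : Fin 4) (u' t : Site 4),
      WQ n κ (u + (n : ℤ) • t) l (u' + (n : ℤ) • t) = shiftK (-((n : ℤ) • t)) (WQ n κ u l u'))
    (hEs : ∀ n κ u l u', WE n κ u l u' = WE n l u' κ u) (hJs : ∀ n κ u l u', WJ n κ u l u' = WJ n l u' κ u)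
    (hΛs : ∀ n κ u l u', WΛ n κ u l u' = WΛ n l u' κ u) (hRs : ∀ n κ u l u', WR n κ u l u' = WR n l u' κ u)
    (hQs : ∀ n κ u l u', WQ n κ u l u' = WQ n l u' κ u)
    (hdiv : ∀ n : ℕ, 2 ≤ n → ∀ [NeZero n], ∀ (l' : Fin 4) (u' u : Site 4), ∑ κ' : Fin 4,
      (fineHess n a (SbfBal n a (cE n) (cVH n) (cΛ n) (cR n) (cK n) (cQ n))
          (Wbf (cE₂ n) (cJ4 n) (cΛ₂ n) (cR₂ n) (cQ₂ n) (WE n) (WJ n) (WΛ n) (WR n) (WQ n)) κ' l' (u - Pi.single κ' 1) u'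
        - fineHess n a (SbfBal n a (cE n) (cVH n) (cΛ n) (cR n) (cK n) (cQ n))
          (Wbf (cE₂ n) (cJ4 n) (cΛ₂ n) (cR₂ n) (cQ₂ n) (WE n) (WJ n) (WΛ n) (WR n) (WQ n)) κ' l' u u') = 0)
    (hrowgh : ∀ n : ℕ, 2 ≤ n → ∀ [NeZero n], ∀ (κ' l' : Fin 4) (b : Site 4), HasSum (fineHessGhQ n a (x₀ n) (cK n) (cQ n) κ' l' b) 0)
    -- (LOCAL) slot-E support and units; slot-R envelope and units (the three local ghost bubbles are SUPPLIED under reading (ii))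
    {ρE : ℕ} {δ₀ kE : ℝ} (hδ₀ : 0 < δ₀) (hδE : ∀ n, δ₀ ≤ δW n)
    (hsuppE : ∀ n κ u l u', ρE < supNorm (u - u') → WE n κ u l u' = 0)
    (hkE : ∀ n : ℕ, 2 ≤ n → |ωgl n * cE₂ n| * CE n ≤ kE * (n : ℝ) ^ 8)
    {CwR δR : ℕ → ℝ} {θR δ₀R kR : ℝ} (hθR : 0 < θR) (hδR : ∀ n, 0 < δR n) (hδ₀R : 0 < δ₀R) (hδRge : ∀ n : ℕ, δ₀R / n ≤ δR n) (hCwR : ∀ n, 0 ≤ CwR n)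
    (hWRenv : ∀ n κ u l u', BiLoc (WR n κ u l u') u u' (CwR n * Real.exp (-(θR / n) * supNorm (u - u'))) (δR n))
    (hkR : ∀ n : ℕ, 2 ≤ n → |ωgl n * cR₂ n| * CwR n * (n : ℝ) ^ 6 ≤ kR)
    -- (Λ) sockets and zero-momentum data
    (hδT : ∀ n, 0 < δT n)
    (hdec : ∀ n : ℕ, 2 ≤ n → ∀ [NeZero n], ∀ κ u l u', WΛ n κ u l u' =
      (∑ m : Fin 4, OneStepResolventKernel.wsum (onLat n (fun y => lamCoeffOf (KInv (N := n) (d := 3)) n m y l u'))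
          (fun v => onLat n (fun y => TΛ n m y κ u) v))
      + (∑ m : Fin 4, OneStepResolventKernel.wsum (onLat n (fun y => lamCoeffOf (KInv (N := n) (d := 3)) n m y κ u))
          (fun v => onLat n (fun y => TΛ n m y l u') v))
      + WA n κ u l u')
    (hTloc : ∀ (n : ℕ) m y κ u, BiLoc (TΛ n m y κ u) ((n : ℤ) • y) ((n : ℤ) • y) (CT n * Real.exp (-δT n * l1 ((n : ℤ) • y - u))) (δT n))
    (hWAa : ∀ n κ u l u', trK (WA n κ u l u') = -WA n κ u l u') (hWAl : ∀ n κ u l u', Loc (WA n κ u l u'))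
    (hTcov : ∀ (n : ℕ) m y κ u t, TΛ n m (y + t) κ (u + (n : ℤ) • t) = shiftK (-((n : ℤ) • t)) (TΛ n m y κ u))
    (hcΛ : ∀ n : ℕ, 2 ≤ n → cΛ n ≠ 0) (hε : ∀ n : ℕ, ε n = 1 ∨ ε n = -1) (hδx : ∀ n, 0 < δx n) (hX : ∀ n u, BiLoc (X n u) u u (Cx n) (δx n))
    (hW1 : ∀ n : ℕ, 2 ≤ n → ∀ [NeZero n], ∀ u,
      comp (comp (Ga n a) (divV (fun κ v => ε n • SbfBal n a (cE n) (cVH n) (cΛ n) (cR n) (cK n) (cQ n) κ v) u)) (Ga n a) =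
        comp (Ga n a) (X n u) - comp (X n u) (Ga n a))
    (hW2 : ∀ n : ℕ, 2 ≤ n → ∀ [NeZero n], ∀ (m : Fin 4) (u : Site 4),
      divV (fun κ v => (-(ε n * (cΛ₂ n / cΛ n))) • TΛ n m 0 κ v) u = comp (X n u) (ffOf (hessFF n m 0)) - comp (ffOf (hessFF n m 0)) (X n u))
    -- (N) the slot-4 tadpole row T₈
    {C₈ : ℝ}
    (h₈ : ∀ n : ℕ, 2 ≤ n → ∀ [NeZero n], |ωgl n * cQ₂ n * ∑ b ∈ (univ : Finset (Fin 4 → Fin n)).image resSite, ((n : ℝ) ^ 4)⁻¹ * (((n : ℝ) ^ 8)⁻¹ *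
      fullSum (fun w : Pt => toReal w μ * toReal w ν * tadpoleTable n a (WQ n) μ ν (b + w) b))| ≤ C₈)
    -- (U)
    (hU : ∀ n : ℕ, 2 ≤ n → ∀ u, |Ru u n| ≤ CU u) :
    D1Drift Lc Js N μ ν := by
  obtain ⟨CGv, hGrp⟩ := hGrp_of_prop12S (N := N) (cVH := cVH) (cE := cE) (cΛ := cΛ) (cR := cR) (cK := cK) (cQ := cQ) (cE₂ := cE₂) (cJ4 := cJ4)
    (cΛ₂ := cΛ₂) (cR₂ := cR₂) (cQ₂ := cQ₂) (x₀ := x₀) (ωgl := ωgl) (ωgh := ωgh) (WE := WE) (WJ := WJ) (WΛ := WΛ) (WR := WR) (WQ := WQ)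
    ha hμν h12 h126 hlam hcE hRsgn hJ4 s hs hωs hcgh hKray hQray hx hδW hE hJ hΛ hR hQ hδ₀ hδE hsuppE hkE hθR hδR hδ₀R hδRge hCwR hWRenv hkR hδT hdec hTloc
    hWAa hWAl hTcov hcΛ hε hδx hX hW1 hW2 h₈
  exact d1Drift_BFx_total_mean_sbp_of_prop12_of_groupsS (grp := grpRec) (g₀ := (3 : Fin 4)) (CG := CGv) Js hμν hN hL hodd ha c hall hθ0 hθ1
    h12 h126 hB1 hK s hωs hlam hδW hE hJ hΛ hR hQ hEc hJc hΛc hRc hQc hEs hJs hΛs hRs hQs hdiv hrowgh grpRec_eq_three_iff hGrp hU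

/-! ## §3 … with T₈ read through the slot-Q SOCKETS and the ghost Ward rows from the ray pins: no rest-word row, no Ward row displayed -/

open Summit.QuantumFields.BalabanUV.Beta.D1BFx.GhostKernelComplete (hasSum_row_fineHessGhQ_ray) in
/-- [folklore] **ROAD BF-x, THE MEAN-LANE «END-ii» END, v1.1 SHAPE — NO LEG ROW, NO REST-WORD ROW AND NO WARD ROW DISPLAYED** — `RoadEndBFxWiredMeanS.d1Drift_BFx_mean_of_prop12S'`
(the mean-lane twin of the owner's `RoadEndBFxWiredS.d1Drift_BFx_of_prop12S'`, v1.1) with `hD₂ hA₂ hδ₂ h2s d2s` DELETED: §2 with (α) its last rest input `h₈` READ THROUGH leaf-04-g14's END-agnostic `NeedleTadpoleRowDecay.h₈_of_blockRate_scaling`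
from slot Q's SOCKETS (block floor `δ₀Q∕n ≤ δQ n`, block-rate envelope `hWQenv : BiLoc (WQ n κ u l u') u u' (CwQ n·e^{−(θQ∕n)‖u−u′‖_∞}) (δQ n)`, units line
`hkQ : |ωgl n·cQ₂ n|·CwQ n·n⁶ ≤ kQ` — slot R's convention letter for letter, the socket block BYTE-IDENTICAL to the owner's v1.1), and (β) the ghost Ward rows `hrowgh` DISCHARGED
on the ray (`x₀ = −cgh`, `cK = cgh·n²`, `cQ = cgh·a` ⇒ `GhostKernelComplete.hasSum_row_fineHessGhQ_ray`).  After this theorem the mean-lane END displays ONLY: `hall`∕`hθ0`∕`hθ1`,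
B1_mean, (K) `hK`, the tie `hωs` + pin `hs` + `hlam`, the pins `hcE`∕`hRsgn`∕`hJ4`, the ray + P13, the five slot-table sockets (+ covariance, bond swap), `hdiv`, slot E's
support ∕ rate floor ∕ units, slot R's and slot Q's SOCKETS, the (Λ) data, (U), `h12`∕`h126` — sockets ∕ letters ∕ pins ∕ printed statements ∕ B1_mean ∕ `hall` ∕ (K), NO leg
row, NO rest-word ROW; the (A2) readout of `WQ` (an2, PIN-MAP Q-PM-1∕2) docks by instantiation.  HONEST: composition BY NAME; `WQ`, `ωgl`, `cQ₂`, `(CwQ, θQ, δQ)`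
ARBITRARY; T₈ and every socket stay OPEN until the pins; 0 root-level binders discharged; (K) NOT closed; NOT D1, NOT `BetaPertH`, NOT continuum, NOT Clay. -/
theorem d1Drift_BFx_mean_sbp_of_prop12S' (Js : ℕ → JetData 3 Lc) (hμν : μ ≠ ν) (hN : N ≠ 0) (hL : 2 ≤ Lc) (hodd : Odd Lc)
    (ha : 0 < a) (c : ℕ → ℝ)
    (h12 : B5.Prop12Printed (fam nOf hn1 MOf a ha)) (h126 : B5.Kernel126_127Printed (kfam nOf MOf))
    -- MEAN grading: the displayed all-scales bound on the step coefficients (row G-an2-4) and bridge B1 in CESÀRO form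
    (hall : AllScalesSeq (fun j => B12Beta.secondMoment (TbalOf Lc Js j) μ ν) κ θ) (hθ0 : 0 ≤ θ) (hθ1 : θ < 1)
    (hB1 : Tendsto (fun m : ℕ => ((∑ j ∈ range m, B12Beta.secondMoment (TbalOf Lc Js j) μ ν) - c (Lc ^ m)) / (m : ℝ)) atTop (𝓝 0))
    (hK : ∀ n : ℕ, 2 ≤ n → Odd n → ∀ [NeZero n], c n =
      ωgl n * B12Beta.secondMoment (TOfRed n a (SbfBal n a (cE n) (cVH n) (cΛ n) (cR n) (cK n) (cQ n))
        (tableRed n (Wbf (cE₂ n) (cJ4 n) (cΛ₂ n) (cR₂ n) (cQ₂ n) (WE n) (WJ n) (WΛ n) (WR n) (WQ n)))) μ ν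
      + ωgh n * B12Beta.secondMoment (PghQ n a (x₀ n) (cK n) (cQ n)) μ ν + ∑ u, Ru u n)
    -- the RESCALED loop-weight tie of reading (ii): displayed scalar family `s`, pinned `s n = n⁻²`; the normalisation
    (s : ℕ → ℝ) (hs : ∀ n : ℕ, 2 ≤ n → s n = ((n : ℝ) ^ 2)⁻¹) (hωs : ∀ n : ℕ, 2 ≤ n → ωgh n * (s n * cK n) ^ 2 = -2 * (ωgl n * cE n ^ 2))
    (hlam : ∀ n : ℕ, 2 ≤ n → ωgl n * cE n ^ 2 = 2 * N ^ 2 * (n : ℝ) ^ 8)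
    -- pins and the ray (the rows' letters)
    (hcE : ∀ n : ℕ, 2 ≤ n → cE n = (n : ℝ) ^ 4) (hRsgn : ∀ n : ℕ, 2 ≤ n → cR n = -cE n) (hJ4 : ∀ n : ℕ, cJ4 n = 0)
    (hcgh : ∀ n : ℕ, |cgh n| ≤ cgh₀) (hKray : ∀ n : ℕ, cK n = cgh n * (n : ℝ) ^ 2) (hQray : ∀ n : ℕ, cQ n = cgh n * a) (hx : ∀ n : ℕ, x₀ n = -cgh n)
    -- slot-table sockets (the END's), covariance, bond swap; `hdiv` (the ghost Ward rows `hrowgh` are a THEOREM on the ray: discharged inside)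
    (hδW : ∀ n, 0 < δW n)
    (hE : ∀ n κ u l u', BiLoc (WE n κ u l u') u u' (CE n) (δW n)) (hJ : ∀ n κ u l u', BiLoc (WJ n κ u l u') u u' (CJ n) (δW n))
    (hΛ : ∀ n κ u l u', BiLoc (WΛ n κ u l u') u u' (CΛt n) (δW n)) (hR : ∀ n κ u l u', BiLoc (WR n κ u l u') u u' (CRt n) (δW n))
    (hQ : ∀ n κ u l u', BiLoc (WQ n κ u l u') u u' (CQ n) (δW n))
    (hEc : ∀ (n : ℕ) (κ : Fin 4) (u : Site 4) (l : Fin 4) (u' t : Site 4),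
      WE n κ (u + (n : ℤ) • t) l (u' + (n : ℤ) • t) = shiftK (-((n : ℤ) • t)) (WE n κ u l u'))
    (hJc : ∀ (n : ℕ) (κ : Fin 4) (u : Site 4) (l : Fin 4) (u' t : Site 4),
      WJ n κ (u + (n : ℤ) • t) l (u' + (n : ℤ) • t) = shiftK (-((n : ℤ) • t)) (WJ n κ u l u'))
    (hΛc : ∀ (n : ℕ) (κ : Fin 4) (u : Site 4) (l : Fin 4) (u' t : Site 4),
      WΛ n κ (u + (n : ℤ) • t) l (u' + (n : ℤ) • t) = shiftK (-((n : ℤ) • t)) (WΛ n κ u l u'))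
    (hRc : ∀ (n : ℕ) (κ : Fin 4) (u : Site 4) (l : Fin 4) (u' t : Site 4),
      WR n κ (u + (n : ℤ) • t) l (u' + (n : ℤ) • t) = shiftK (-((n : ℤ) • t)) (WR n κ u l u'))
    (hQc : ∀ (n : ℕ) (κ : Fin 4) (u : Site 4) (l : Fin 4) (u' t : Site 4),
      WQ n κ (u + (n : ℤ) • t) l (u' + (n : ℤ) • t) = shiftK (-((n : ℤ) • t)) (WQ n κ u l u'))
    (hEs : ∀ n κ u l u', WE n κ u l u' = WE n l u' κ u) (hJs : ∀ n κ u l u', WJ n κ u l u' = WJ n l u' κ u)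
    (hΛs : ∀ n κ u l u', WΛ n κ u l u' = WΛ n l u' κ u) (hRs : ∀ n κ u l u', WR n κ u l u' = WR n l u' κ u)
    (hQs : ∀ n κ u l u', WQ n κ u l u' = WQ n l u' κ u)
    (hdiv : ∀ n : ℕ, 2 ≤ n → ∀ [NeZero n], ∀ (l' : Fin 4) (u' u : Site 4), ∑ κ' : Fin 4,
      (fineHess n a (SbfBal n a (cE n) (cVH n) (cΛ n) (cR n) (cK n) (cQ n))
          (Wbf (cE₂ n) (cJ4 n) (cΛ₂ n) (cR₂ n) (cQ₂ n) (WE n) (WJ n) (WΛ n) (WR n) (WQ n)) κ' l' (u - Pi.single κ' 1) u'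
        - fineHess n a (SbfBal n a (cE n) (cVH n) (cΛ n) (cR n) (cK n) (cQ n))
          (Wbf (cE₂ n) (cJ4 n) (cΛ₂ n) (cR₂ n) (cQ₂ n) (WE n) (WJ n) (WΛ n) (WR n) (WQ n)) κ' l' u u') = 0)
    -- (LOCAL) slot-E support and units; slot-R envelope and units (the three local ghost bubbles are SUPPLIED under reading (ii))
    {ρE : ℕ} {δ₀ kE : ℝ} (hδ₀ : 0 < δ₀) (hδE : ∀ n, δ₀ ≤ δW n)
    (hsuppE : ∀ n κ u l u', ρE < supNorm (u - u') → WE n κ u l u' = 0)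
    (hkE : ∀ n : ℕ, 2 ≤ n → |ωgl n * cE₂ n| * CE n ≤ kE * (n : ℝ) ^ 8)
    {CwR δR : ℕ → ℝ} {θR δ₀R kR : ℝ} (hθR : 0 < θR) (hδR : ∀ n, 0 < δR n) (hδ₀R : 0 < δ₀R) (hδRge : ∀ n : ℕ, δ₀R / n ≤ δR n) (hCwR : ∀ n, 0 ≤ CwR n)
    (hWRenv : ∀ n κ u l u', BiLoc (WR n κ u l u') u u' (CwR n * Real.exp (-(θR / n) * supNorm (u - u'))) (δR n))
    (hkR : ∀ n : ℕ, 2 ≤ n → |ωgl n * cR₂ n| * CwR n * (n : ℝ) ^ 6 ≤ kR)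
    -- (Λ) sockets and zero-momentum data
    (hδT : ∀ n, 0 < δT n)
    (hdec : ∀ n : ℕ, 2 ≤ n → ∀ [NeZero n], ∀ κ u l u', WΛ n κ u l u' =
      (∑ m : Fin 4, OneStepResolventKernel.wsum (onLat n (fun y => lamCoeffOf (KInv (N := n) (d := 3)) n m y l u'))
          (fun v => onLat n (fun y => TΛ n m y κ u) v))
      + (∑ m : Fin 4, OneStepResolventKernel.wsum (onLat n (fun y => lamCoeffOf (KInv (N := n) (d := 3)) n m y κ u))
          (fun v => onLat n (fun y => TΛ n m y l u') v))
      + WA n κ u l u')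
    (hTloc : ∀ (n : ℕ) m y κ u, BiLoc (TΛ n m y κ u) ((n : ℤ) • y) ((n : ℤ) • y) (CT n * Real.exp (-δT n * l1 ((n : ℤ) • y - u))) (δT n))
    (hWAa : ∀ n κ u l u', trK (WA n κ u l u') = -WA n κ u l u') (hWAl : ∀ n κ u l u', Loc (WA n κ u l u'))
    (hTcov : ∀ (n : ℕ) m y κ u t, TΛ n m (y + t) κ (u + (n : ℤ) • t) = shiftK (-((n : ℤ) • t)) (TΛ n m y κ u))
    (hcΛ : ∀ n : ℕ, 2 ≤ n → cΛ n ≠ 0) (hε : ∀ n : ℕ, ε n = 1 ∨ ε n = -1) (hδx : ∀ n, 0 < δx n) (hX : ∀ n u, BiLoc (X n u) u u (Cx n) (δx n))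
    (hW1 : ∀ n : ℕ, 2 ≤ n → ∀ [NeZero n], ∀ u,
      comp (comp (Ga n a) (divV (fun κ v => ε n • SbfBal n a (cE n) (cVH n) (cΛ n) (cR n) (cK n) (cQ n) κ v) u)) (Ga n a) =
        comp (Ga n a) (X n u) - comp (X n u) (Ga n a))
    (hW2 : ∀ n : ℕ, 2 ≤ n → ∀ [NeZero n], ∀ (m : Fin 4) (u : Site 4),
      divV (fun κ v => (-(ε n * (cΛ₂ n / cΛ n))) • TΛ n m 0 κ v) u = comp (X n u) (ffOf (hessFF n m 0)) - comp (ffOf (hessFF n m 0)) (X n u))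
    -- (N) slot Q's SOCKETS (the (A2) readout of `WQ`: a decaying bi-localisation envelope at a BLOCK-scale rate floor and its units line — T₈ ⟸ `NeedleTadpoleRowDecay`)
    {CwQ δQ : ℕ → ℝ} {θQ δ₀Q kQ : ℝ} (hθQ : 0 < θQ) (hδQ : ∀ n, 0 < δQ n) (hδ₀Q : 0 < δ₀Q) (hδQge : ∀ n : ℕ, δ₀Q / n ≤ δQ n) (hCwQ : ∀ n, 0 ≤ CwQ n)
    (hWQenv : ∀ n κ u l u', BiLoc (WQ n κ u l u') u u' (CwQ n * Real.exp (-(θQ / n) * supNorm (u - u'))) (δQ n))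
    (hkQ : ∀ n : ℕ, 2 ≤ n → |ωgl n * cQ₂ n| * CwQ n * (n : ℝ) ^ 6 ≤ kQ)
    -- (U)
    (hU : ∀ n : ℕ, 2 ≤ n → ∀ u, |Ru u n| ≤ CU u) :
    D1Drift Lc Js N μ ν := by
  -- (β) the ghost Ward rows on the ray (as the owner's `RoadEndBFxWiredS.d1Drift_BFx_of_prop12S'` ∕ `RoadEndBFxRecutRayS`)
  have hrowgh : ∀ n : ℕ, 2 ≤ n → ∀ [NeZero n], ∀ (κ' l' : Fin 4) (b : Site 4), HasSum (fineHessGhQ n a (x₀ n) (cK n) (cQ n) κ' l' b) 0 := by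
    intro n _ _ κ' l' b
    rw [hx n, hKray n, hQray n]
    exact hasSum_row_fineHessGhQ_ray n a ha (cgh n) κ' l' b
  -- (α) T₈ from slot Q's sockets
  exact d1Drift_BFx_mean_sbp_of_prop12S Js hμν hN hL hodd ha c h12 h126 hall hθ0 hθ1 hB1 hK s hs hωs hlam hcE hRsgn hJ4 hcgh hKray hQray hx
    hδW hE hJ hΛ hR hQ hEc hJc hΛc hRc hQc hEs hJs hΛs hRs hQs hdiv hrowgh hδ₀ hδE hsuppE hkE hθR hδR hδ₀R hδRge hCwR hWRenv hkR hδT hdec hTloc hWAa hWAl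
    hTcov hcΛ hε hδx hX hW1 hW2 (h₈_of_blockRate_scaling ha hθQ hδQ hδ₀Q hδQge hCwQ hWQenv hkQ μ ν) hU

end Summit.QuantumFields.BalabanUV.Beta.D1BFx.RoadEndBFxWiredMeanSbpS

end
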